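import Summits.NavierStokesRegularity.NavierStokesRegularity.Theses.AxisymmetricExtremality
import Summits.NavierStokesRegularity.NavierStokesRegularity.Theorems.AxisymmetricExtremalityMinimalDatumPFoldThresholdFinite
import Summits.NavierStokesRegularity.NavierStokesRegularity.Theorems.AxisymmetricExtremalityMinimalDatumPFoldNotAeZero
import Summits.NavierStokesRegularity.NavierStokesRegularity.Theorems.AxisymmetricExtremalityMinimalDatumPFoldScaleRigidity
import Summits.NavierStokesRegularity.NavierStokesRegularity.Theorems.AxisymmetricExtremalityMinimalDatumPFoldShiftRigidity
import Summits.NavierStokesRegularity.NavierStokesRegularity.Theorems.AxisymmetricExtremalityMinimalDatumPFoldRecentre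
import Summits.NavierStokesRegularity.NavierStokesRegularity.Theorems.AxisymmetricExtremalityMinimalDatumPFoldAeToExact

/-!
# BC3 skeleton (reshaped by lead c1) — crux `MinimalDatumPFold` (stmt-NavierStokesRegularity-15452)
## route-NavierStokesRegularity-AxisymmetricExtremality · line `registered` = `Lines/birth.lean`

Reshape (lead prover-line-stmt-NavierStokesRegularity-15452-c1-0, 2026-08-17) of the registered birth
skeleton (sha f576bd54…): the front-end stub `stub_thresholdFinite_of_clayFailure` and the load-bearing
stub `stub_smithFixedModSim` are kept BYTE-IDENTICAL; the lift stub `stub_liftModSim` (fixed mod Sim ⇒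
exactly `R_{2π/p}`-equivariant minimal datum, size M on paper but L in Lean) is split into FIVE
registered stubs, each a true self-contained lemma over existing declarations:

* `stub_minimalDatum_not_aeZero` — a minimal blow-up datum is not a.e. zero (an a.e.-zero datum has
  the trivial global Kato solution `u t = if t = 0 then u₀ else 0`: every duality integral vanishes).
* `stub_liftScaleRigidity` — if `u₀ ∈ L³` is not a.e. zero and `λ u₀(λ R x − x₀) = R u₀(x)` a.e.
  (`R = R_{2π/p}` about the `x₂`-axis, `λ > 0`), then `λ = 1`: for `λ ≠ 1` the affine map
  `B x = λ R x − x₀` has a fixed point `x*`, `B⁻¹(ball(x*, r)) = ball(x*, r/λ)`, and the finite measure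
  `G = |u₀|³ dx` is `B`-invariant (change of variables, `|R v| = |v|`), so `r ↦ G(ball(x*, r))` is
  invariant under `r ↦ λ r`, hence constant, hence `0` (continuity of `G` from above at `{x*}`), so
  `u₀ = 0` a.e.
* `stub_liftShiftRigidity` — if `u₀ ∈ L³` is not a.e. zero and `u₀(R x − x₀) = R u₀(x)` a.e., then
  `(x₀)₂ = 0`: otherwise `B x = R x − x₀` is a screw motion, the slabs `{n h ≤ x₂ < (n+1) h}`,
  `h = (x₀)₂`, are permuted by `B`, have equal `G`-measure and finite sum, so `G = 0`.
* `stub_liftRecentre` — with `(x₀)₂ = 0` and `p ≥ 2`, solve `(R − I) e = x₀` in the horizontal plane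
  (`det = 2 − 2 cos(2π/p) > 0`); `u₁ := u₀(· + e)` is a.e. `R`-equivariant and is a minimal blow-up
  datum (`IsMinimalBlowupDatum.rescaleData_translate` with `c = 1`, `exists_represents_rescaleData_norm_eq`).
* `stub_liftAeToExact` — an a.e. `R`-equivariant minimal blow-up datum can be modified on an
  `R`-invariant null set (the `ℤ/p`-orbit of the bad set; `R^p = id`) to an EXACTLY `R`-equivariant
  one, which is again a minimal blow-up datum (`IsMinimalBlowupDatum ν · g` is invariant under a.e.
  modification: `MemLp`, `Represents`, `IsWeaklyDivFree` are a.e. notions and a global Kato solution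
  survives resetting its time-zero slice, all duality identities being integrals).

The composition `MinimalDatumPFold_of_sigs : SIG₁ → … → SIG₇ → (crux written out)` is kernel-checked
(pure logic + `rescaleData 1 = id` by `one_smul`), `MinimalDatumPFold_iff_written` is `Iff.rfl`, and
`MinimalDatumPFold_of : AxisymmetricExtremality.MinimalDatumPFold` is the only crux-headed theorem
(sorries = the 7 stubs exactly). Typing: the rotation about the `x₂`-axis is written OUT as in the
route file (`Literature.Analysis.FluidPDE.rotZ (2π/p)` unfolded, `rfl`), so this file imports only the
route file. Hardest stub: `stub_smithFixedModSim` (the crux's whole open content: Smith fixed point on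
`M̂ = M/Sim`, needs `F_p`-acyclicity of `M̂`, which no source supplies) — held by the lead.
Disproof used: none exists for this crux (`ledger crux ls`: no `Disproof.lean`, no `Negative/`).
-/

set_option linter.dupNamespace false

namespace Summit.NavierStokesRegularity.NavierStokesRegularity.Cruxes.MinimalDatumPFold.Birth

/-- ROUTINE FRONT END (provable now, size M; registered signature UNCHANGED). If Clay (A) fails at viscosity `ν` — some smooth, divergence-free, rapidly decaying datum `v₀` has no jointly smooth bounded-energy global solution — then `ρ_max^pure(ν) < ⊤`. Proof route: `clay_solution_of_hasGlobalKatoSolution_holds` (Kato→Clay, PROVED) makes `v₀` Kato-singular; `v₀` is Schwartz (`ContDiff ⊤` + `HasRapidSpatialDecay` are exactly the Schwartz seminorm bounds; `complexify` is an `ℝ`-linear isometry), so Mathlib's `SchwartzMap.memSobolev` + the tree bridge `memSobolev_two_iff_eFourierSobolevNorm_lt_top_holds` + `MemFourierSobolev.memHomSobolev_holds` give `complexify ∘ v₀ ∈ Ḣ^{1/2} ∩ L²`, whence a representing class `g = HomSobolev.ofFun _ _` (`HomSobolev.represents_ofFun_holds`) with `‖g‖ₑ < ⊤`; `v₀ ∈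 L³` and weakly divergence-free as in the first block of `typeICertificateLadder_noBlowupToClay_proof`; if `ρ_max^pure(ν) = ⊤` then `‖g‖ₑ < ρ_max^pure(ν)` and `hasGlobalKatoSolution_of_lt_rusinSverakRhoMaxPure` contradicts Kato-singularity. [sources: Kato1984 Thm 4; LemarieRieusset2002 Ch. 15, 27; RusinSverak2011 §1] LANDED (p147201): this is `Summit.NavierStokesRegularity.NavierStokesRegularity.Theorems.stub_thresholdFinite_of_clayFailure`. -/
theorem stub_thresholdFinite_of_clayFailure :
    ∀ ν : ℝ, 0 < ν → (∃ v₀ : EuclideanSpace ℝ (Fin 3) → EuclideanSpace ℝ (Fin 3), ContDiff ℝ (⊤ : ℕ∞) v₀ ∧ Literature.Analysis.FluidPDE.NSWave0.IsDivFree v₀ ∧ Literature.Analysis.FluidPDE.HasRapidSpatialDecay v₀ ∧ ¬ ∃ (u : ℝ → EuclideanSpace ℝ (Fin 3) → EuclideanSpace ℝ (Fin 3)) (p : ℝ → EuclideanSpace ℝ (Fin 3) → ℝ), Literature.Analysis.FluidPDE.IsSmoothOnHalfSpace u ∧ Literature.Analysis.FluidPDE.IsSmoothOnHalfSpace p ∧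 Literature.Analysis.FluidPDE.IsNavierStokesSolution ν 0 v₀ u p ∧ Literature.Analysis.FluidPDE.HasBoundedEnergy u) → Literature.Analysis.FluidPDE.rusinSverakRhoMaxPure ν < ⊤ :=
  Summit.NavierStokesRegularity.NavierStokesRegularity.Theorems.stub_thresholdFinite_of_clayFailure

/-- THE LOAD-BEARING STUB (size XL; registered signature UNCHANGED; held by the lead): the fixed-point output of P. A. Smith theory on the Rusin–Šverák moduli space `M̂(ν) = M(ν)/Sim`, stated at the level of DATA: if `ρ_max^pure(ν) < ⊤` (so `M(ν) ≠ ∅`, compact mod Sim — PROVED: `rusin_sverak_minimal_blowup_holds`, `rusin_sverak_minimal_data_compact_holds`), then for every `N` there are `p ≥ max(N,2)` and a minimal blow-up datum `(u₀, g)` whose class in `M̂(ν)` is fixed by `R = R_{2π/p}`: for some `λ > 0`, `x₀`, `(λ u₀(λ · − x₀)) (R x) = R (u₀ x)` for a.e. `x`. Intended proof: `O(2)` acts continuously on the compact metric space `M̂(ν)`; IF `M̂(ν)` is `F_p`-acyclic (Čech) for infinitely many primes `p`, Smith's theorem (AlldayPuppe1993 Cor. 1.4.7, Thm. 3.1.10)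 gives the fixed point. Why it might fail: `M̂` may be a finite union of orbits with `χ = 0` and no acyclicity; every cohomological criterion collapses to the claim itself (2001 dictionary); no analytic description of `M̂` exists; Mathlib has no Čech cohomology. [sources: RusinSverak2011 Cor 4.3; AlldayPuppe1993 (1.4.7), (3.1.10), Cor 3.1.13 p.136; arXiv:1012.0145; arXiv:0908.3349; JiaSverak2013; arXiv:0804.1124] -/
theorem stub_smithFixedModSim :
    ∀ ν : ℝ, 0 < ν → Literature.Analysis.FluidPDE.rusinSverakRhoMaxPure ν < ⊤ → ∀ N : ℕ, ∃ p : ℕ, N ≤ p ∧ 2 ≤ p ∧ ∃ (u₀ : EuclideanSpace ℝ (Fin 3) → EuclideanSpace ℝ (Fin 3)) (g : Literature.Analysis.FunctionSpaces.HomSobolev (EuclideanSpace ℝ (Fin 3)) (EuclideanSpace ℂ (Fin 3)) (1 / 2 : ℝ)), Literature.Analysis.FluidPDE.IsMinimalBlowupDatum ν u₀ g ∧ ∃ (lam : ℝ) (x₀ : EuclideanSpace ℝ (Fin 3)), 0 < lam ∧ ∀ᵐ x ∂(MeasureTheory.volume : MeasureTheory.Measure (EuclideanSpace ℝ (Fin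 3))), Literature.Analysis.FluidPDE.rescaleData lam (fun y => u₀ (y - x₀)) (WithLp.toLp 2 ![Real.cos (2 * Real.pi / p) * x 0 - Real.sin (2 * Real.pi / p) * x 1, Real.sin (2 * Real.pi / p) * x 0 + Real.cos (2 * Real.pi / p) * x 1, x 2]) = WithLp.toLp 2 ![Real.cos (2 * Real.pi / p) * u₀ x 0 - Real.sin (2 * Real.pi / p) * u₀ x 1, Real.sin (2 * Real.pi / p) * u₀ x 0 + Real.cos (2 * Real.pi / p) * u₀ x 1, u₀ x 2] := by
  sorry

/-- LIFT, piece 0 (size S): a Rusin–Šverák minimal blow-up datum is not a.e. zero. If `u₀ =ᵐ 0`, the field `u t := if t = 0 then u₀ else 0` is a global Kato solution of `u₀` (`HasGlobalKatoSolution`): every slice is weakly divergence-free (`u₀` is, `0` is), every duality integral in `IsMildNSSolutionFrom ν 0 u₀ u t` vanishes (integrands a.e. zero in `x`, resp. zero for `τ ≠ 0`), `t ↦ u t` is `L³`-continuous (all slices are a.e. `0`), `u 0 = u₀`, and `uncurry u = 0` on `(0,∞) × ℝ³` — contradicting the clause `¬ HasGlobalKatoSolution ν u₀` of `IsMinimalBlowupDatum`.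 [sources: Kato1984 Thm 4 (the class); RusinSverak2011 Cor 4.3 (definition of M); folklore] LANDED (p146958): this is `Summit.NavierStokesRegularity.NavierStokesRegularity.Theorems.stub_minimalDatum_not_aeZero`. -/
theorem stub_minimalDatum_not_aeZero :
    ∀ (ν : ℝ) (u₀ : EuclideanSpace ℝ (Fin 3) → EuclideanSpace ℝ (Fin 3)) (g : Literature.Analysis.FunctionSpaces.HomSobolev (EuclideanSpace ℝ (Fin 3)) (EuclideanSpace ℂ (Fin 3)) (1 / 2 : ℝ)), Literature.Analysis.FluidPDE.IsMinimalBlowupDatum ν u₀ g → ¬ (u₀ =ᵐ[(MeasureTheory.volume : MeasureTheory.Measure (EuclideanSpace ℝ (Fin 3)))] (0 : EuclideanSpace ℝ (Fin 3) → EuclideanSpace ℝ (Fin 3))) :=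
  Summit.NavierStokesRegularity.NavierStokesRegularity.Theorems.stub_minimalDatum_not_aeZero

/-- LIFT, piece 1 — SCALE RIGIDITY (size M, pure real analysis): if `u₀ ∈ L³(ℝ³)` is not a.e. zero, `λ > 0`, and `λ u₀(λ R x − x₀) = R (u₀ x)` for a.e. `x` (`R = R_{2π/p}` the rotation about the `x₂`-axis written out; the left side is `rescaleData λ (u₀(· − x₀)) (R x)`), then `λ = 1`. Proof: `|R v| = |v|`, so `|u₀(x)|³ = λ³ |u₀(B x)|³` a.e. with `B x = λ R x − x₀`; by the change of variables `z = B x` (`dz = λ³ dx`: `R` is a linear isometry, Mathlib `Measure.map_linearMap_addHaar_eq_smul_addHaar` / `lintegral_comp_smul`-type lemmas) the finite measure `G(A) = ∫_A |u₀|³` satisfies `G(B⁻¹ A) = G(A)`. If `λ ≠ 1`, `B` has a (unique) fixed point `x*` (`I − λR` is invertible: `‖λ R‖ = λ`), and `B⁻¹(ball(x*, r)) = ball(x*, r/λ)`, so `G(ball(x*, r)) = G(ball(x*, λ^n r))` for all `n ∈ ℤ`; letting `λ^n r → 0` (continuity from above, `G({x*}) = 0`) gives `G(ball(x*, r)) =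 0` for all `r`, hence `G = 0`, `u₀ = 0` a.e. — contradiction. [sources: RusinSverak2011 §1 p.3 (the symmetry group Sim); folklore] LANDED (p147324): this is `Summit.NavierStokesRegularity.NavierStokesRegularity.Theorems.stub_liftScaleRigidity`. -/
theorem stub_liftScaleRigidity :
    ∀ (p : ℕ) (u₀ : EuclideanSpace ℝ (Fin 3) → EuclideanSpace ℝ (Fin 3)), MeasureTheory.MemLp u₀ 3 (MeasureTheory.volume : MeasureTheory.Measure (EuclideanSpace ℝ (Fin 3))) → ¬ (u₀ =ᵐ[(MeasureTheory.volume : MeasureTheory.Measure (EuclideanSpace ℝ (Fin 3)))] (0 : EuclideanSpace ℝ (Fin 3) → EuclideanSpace ℝ (Fin 3))) → ∀ (lam : ℝ) (x₀ : EuclideanSpace ℝ (Fin 3)), 0 < lam → (∀ᵐ x ∂(MeasureTheory.volume : MeasureTheory.Measure (EuclideanSpace ℝ (Fin 3))), Literature.Analysis.FluidPDE.rescaleData lam (fun y => u₀ (y - x₀)) (WithLp.toLp 2 ![Real.cos (2 * Real.pi / p) * x 0 - Real.sin (2 * Real.pi / p) * x 1, Real.sin (2 * Real.pi / p) * x 0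 + Real.cos (2 * Real.pi / p) * x 1, x 2]) = WithLp.toLp 2 ![Real.cos (2 * Real.pi / p) * u₀ x 0 - Real.sin (2 * Real.pi / p) * u₀ x 1, Real.sin (2 * Real.pi / p) * u₀ x 0 + Real.cos (2 * Real.pi / p) * u₀ x 1, u₀ x 2]) → lam = 1 :=
  Summit.NavierStokesRegularity.NavierStokesRegularity.Theorems.stub_liftScaleRigidity

/-- LIFT, piece 2 — SHIFT RIGIDITY (size M, pure real analysis): if `u₀ ∈ L³(ℝ³)` is not a.e. zero and `u₀(R x − x₀) = R (u₀ x)` for a.e. `x` (`R = R_{2π/p}` about the `x₂`-axis, written out), then the axial component `(x₀)₂` vanishes. Proof: `B x = R x − x₀` is a measure-preserving isometry with `(B x)₂ = x₂ − (x₀)₂`, and `|u₀| = |u₀ ∘ B|` a.e., so `G(A) = ∫_A |u₀|³` satisfies `G(B⁻¹ A) = G(A)`. If `h := (x₀)₂ ≠ 0`, the slabs `S_n = {x | n h ≤ x₂ < (n+1) h}` (`n ∈ ℤ`; for `h < 0` reindex) satisfy `B⁻¹ S_n = S_{n+1}`, so all `G(S_n)` are equal while `∑_n G(S_n) = G(ℝ³)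 = ‖u₀‖₃³ < ∞`; hence `G(S_n) = 0` for all `n`, `G = 0`, `u₀ = 0` a.e. — contradiction. [sources: RusinSverak2011 §1 p.3; KNSS2009 §1 (rotations R_θ); folklore] LANDED (p148584): this is `Summit.NavierStokesRegularity.NavierStokesRegularity.Theorems.stub_liftShiftRigidity`. -/
theorem stub_liftShiftRigidity :
    ∀ (p : ℕ) (u₀ : EuclideanSpace ℝ (Fin 3) → EuclideanSpace ℝ (Fin 3)), MeasureTheory.MemLp u₀ 3 (MeasureTheory.volume : MeasureTheory.Measure (EuclideanSpace ℝ (Fin 3))) → ¬ (u₀ =ᵐ[(MeasureTheory.volume : MeasureTheory.Measure (EuclideanSpace ℝ (Fin 3)))] (0 : EuclideanSpace ℝ (Fin 3) → EuclideanSpace ℝ (Fin 3))) → ∀ x₀ : EuclideanSpace ℝ (Fin 3), (∀ᵐ x ∂(MeasureTheory.volume : MeasureTheory.Measure (EuclideanSpace ℝ (Fin 3))), u₀ (WithLp.toLp 2 ![Real.cos (2 * Real.pi / p) * x 0 - Real.sin (2 * Real.pi / p) * x 1, Real.sin (2 * Real.pi / p) * x 0 + Real.cos (2 * Real.pi / p)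 * x 1, x 2] - x₀) = WithLp.toLp 2 ![Real.cos (2 * Real.pi / p) * u₀ x 0 - Real.sin (2 * Real.pi / p) * u₀ x 1, Real.sin (2 * Real.pi / p) * u₀ x 0 + Real.cos (2 * Real.pi / p) * u₀ x 1, u₀ x 2]) → x₀ 2 = 0 :=
  Summit.NavierStokesRegularity.NavierStokesRegularity.Theorems.stub_liftShiftRigidity

/-- LIFT, piece 3 — RECENTRING THE AXIS (size M): let `(u₀, g)` be a minimal blow-up datum with `u₀(R x − x₀) = R (u₀ x)` a.e., `R = R_{2π/p}` (`p ≥ 2`) and `(x₀)₂ = 0`. With `c = cos(2π/p) ≠ 1`, `s = sin(2π/p)`, `det = (c − 1)² + s² = 2 − 2c > 0`, put `e := ((c−1) (x₀)₀ + s (x₀)₁, −s (x₀)₀ + (c−1) (x₀)₁, 0) / det`, the solution of `(R − I) e = x₀`. Then `u₁ := u₀(· + e)` satisfies `u₁(R x) = u₀(R x + e) = u₀(R (x + e) − x₀) = R u₀(x + e) = R u₁(x)` for a.e. `x` (the hypothesis at the point `x + e`; translations are measure preserving, `QuasiMeasurePreserving.ae`), and `(u₁, g₁)` is a minimal blow-up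 datum for a class `g₁` of the same norm representing it (`exists_represents_rescaleData_norm_eq u₀ g one_pos (−e)`, `IsMinimalBlowupDatum.rescaleData_translate` with `c = 1`, `rescaleData_one`). [sources: RusinSverak2011 §1 p.3 (translation invariance of M); folklore] LANDED (p147155): this is `Summit.NavierStokesRegularity.NavierStokesRegularity.Theorems.stub_liftRecentre`. -/
theorem stub_liftRecentre :
    ∀ (ν : ℝ) (p : ℕ), 2 ≤ p → ∀ (u₀ : EuclideanSpace ℝ (Fin 3) → EuclideanSpace ℝ (Fin 3)) (g : Literature.Analysis.FunctionSpaces.HomSobolev (EuclideanSpace ℝ (Fin 3)) (EuclideanSpace ℂ (Fin 3)) (1 / 2 : ℝ)), Literature.Analysis.FluidPDE.IsMinimalBlowupDatum ν u₀ g → ∀ x₀ : EuclideanSpace ℝ (Fin 3), x₀ 2 = 0 → (∀ᵐ x ∂(MeasureTheory.volume : MeasureTheory.Measure (EuclideanSpace ℝ (Fin 3))), u₀ (WithLp.toLp 2 ![Real.cos (2 * Real.pi / p) * x 0 - Real.sin (2 * Real.pi / p) * x 1, Real.sin (2 * Real.pi / p) * x 0 + Real.cos (2 * Real.pi / p) *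 x 1, x 2] - x₀) = WithLp.toLp 2 ![Real.cos (2 * Real.pi / p) * u₀ x 0 - Real.sin (2 * Real.pi / p) * u₀ x 1, Real.sin (2 * Real.pi / p) * u₀ x 0 + Real.cos (2 * Real.pi / p) * u₀ x 1, u₀ x 2]) → ∃ (u₁ : EuclideanSpace ℝ (Fin 3) → EuclideanSpace ℝ (Fin 3)) (g₁ : Literature.Analysis.FunctionSpaces.HomSobolev (EuclideanSpace ℝ (Fin 3)) (EuclideanSpace ℂ (Fin 3)) (1 / 2 : ℝ)), Literature.Analysis.FluidPDE.IsMinimalBlowupDatum ν u₁ g₁ ∧ ∀ᵐ x ∂(MeasureTheory.volume : MeasureTheory.Measure (EuclideanSpace ℝ (Fin 3))), u₁ (WithLp.toLp 2 ![Real.cos (2 * Real.pi / p) * x 0 - Real.sin (2 * Real.pi / p) * x 1, Real.sin (2 * Real.pi / p) * x 0 + Real.cos (2 * Real.pi / p) * x 1, x 2]) = WithLp.toLp 2 ![Real.cos (2 * Real.pi / p) * u₁ x 0 - Real.sin (2 * Real.pi / p) * u₁ x 1, Real.sin (2 * Real.pi / p) * u₁ x 0 + Real.cos (2 * Real.pi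 / p) * u₁ x 1, u₁ x 2] :=
  Summit.NavierStokesRegularity.NavierStokesRegularity.Theorems.stub_liftRecentre

/-- LIFT, piece 4 — FROM A.E. TO EXACT EQUIVARIANCE (size M): an a.e. `R`-equivariant minimal blow-up datum `(u₁, g₁)` (`u₁(R x) = R (u₁ x)` for a.e. `x`, `R = R_{2π/p}`, `p ≥ 2`) yields an EXACTLY `R`-equivariant minimal blow-up datum `(u₂, g₁)`. Proof: let `N` be the (null) bad set and `Z := ⋃_{k<p} R_{2πk/p}⁻¹ N` the union of the `ℤ/p`-orbits meeting `N` (null: each `R_φ`, written out, is a measure-preserving linear isometry; `R`-invariant: `R_φ ∘ R_ψ = R_{φ+ψ}` by `cos_add`/`sin_add` and `R_{2π} = id`); set `u₂ x := if x ∈ Z then 0 else u₁ x`. For `x ∉ Z`: `R x ∉ Z`, `x ∉ N`, so `u₂(R x) = u₁(R x) = R u₁(x) = R u₂(x)`; for `x ∈ Z`: `R x ∈ Z` and both sides are `0` (`R 0 = 0`). Finally `u₂ =ᵐ u₁` and `IsMinimalBlowupDatum ν · g₁` is invariant under a.e. modification: `MemLp.ae_eq`, `HomSobolev.Represents.congr_ae`,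 `IsWeaklyDivFree.congr_ae`, and a global Kato solution `u` of `u₂` becomes one of `u₁` after resetting `u 0 := u₁` (the duality identities `IsMildNSSolutionFrom` and the `L³`-continuity are integrals in `x`, the time integrals see `τ = 0` as a null set, measurability is on `(0,∞) × ℝ³`). [sources: RusinSverak2011 §1 p.3; folklore] LANDED (p149205): this is `Summit.NavierStokesRegularity.NavierStokesRegularity.Theorems.stub_liftAeToExact`. -/
theorem stub_liftAeToExact :
    ∀ (ν : ℝ) (p : ℕ), 2 ≤ p → ∀ (u₁ : EuclideanSpace ℝ (Fin 3) → EuclideanSpace ℝ (Fin 3)) (g₁ : Literature.Analysis.FunctionSpaces.HomSobolev (EuclideanSpace ℝ (Fin 3)) (EuclideanSpace ℂ (Fin 3)) (1 / 2 : ℝ)), Literature.Analysis.FluidPDE.IsMinimalBlowupDatum ν u₁ g₁ → (∀ᵐ x ∂(MeasureTheory.volume : MeasureTheory.Measure (EuclideanSpace ℝ (Fin 3))), u₁ (WithLp.toLp 2 ![Real.cos (2 * Real.pi / p) * x 0 - Real.sin (2 * Real.pi / p) * x 1, Real.sin (2 * Real.pi / p) * x 0 + Real.cos (2 * Real.pi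 / p) * x 1, x 2]) = WithLp.toLp 2 ![Real.cos (2 * Real.pi / p) * u₁ x 0 - Real.sin (2 * Real.pi / p) * u₁ x 1, Real.sin (2 * Real.pi / p) * u₁ x 0 + Real.cos (2 * Real.pi / p) * u₁ x 1, u₁ x 2]) → ∃ (u₂ : EuclideanSpace ℝ (Fin 3) → EuclideanSpace ℝ (Fin 3)) (g₂ : Literature.Analysis.FunctionSpaces.HomSobolev (EuclideanSpace ℝ (Fin 3)) (EuclideanSpace ℂ (Fin 3)) (1 / 2 : ℝ)), Literature.Analysis.FluidPDE.IsMinimalBlowupDatum ν u₂ g₂ ∧ ∀ x : EuclideanSpace ℝ (Fin 3), u₂ (WithLp.toLp 2 ![Real.cos (2 * Real.pi / p) * x 0 - Real.sin (2 * Real.pi / p) * x 1, Real.sin (2 * Real.pi / p) * x 0 + Real.cos (2 * Real.pi / p) * x 1, x 2]) = WithLp.toLp 2 ![Real.cos (2 * Real.pi / p) * u₂ x 0 - Real.sin (2 * Real.pi / p) * u₂ x 1, Real.sin (2 * Real.pi / p) * u₂ x 0 + Real.cos (2 * Real.pi / p) * u₂ x 1, u₂ x 2] :=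
  Summit.NavierStokesRegularity.NavierStokesRegularity.Theorems.stub_liftAeToExact

/-- COMPOSITION (kernel-checked, no sorry, standard axioms): the seven stub SIGNATURES imply the crux written out. Given `ν > 0`, a Clay failure and `N`: stub₁ gives `ρ_max^pure(ν) < ⊤`; stub₂ gives `p ≥ max(N,2)` and a minimal blow-up datum `(u₀,g)` fixed modulo Sim by `R_{2π/p}` (`λ`, `x₀`); piece 0 says `u₀` is not a.e. zero, so scale rigidity forces `λ = 1` (and `rescaleData 1 = id` by `one_smul`) and shift rigidity forces `(x₀)₂ = 0`; recentring gives an a.e.-equivariant minimal datum and piece 4 an exactly equivariant one. The conclusion is the route decl's body verbatim (`MinimalDatumPFold_iff_written` is `Iff.rfl`). -/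
theorem MinimalDatumPFold_of_sigs :
    (∀ ν : ℝ, 0 < ν → (∃ v₀ : EuclideanSpace ℝ (Fin 3) → EuclideanSpace ℝ (Fin 3), ContDiff ℝ (⊤ : ℕ∞) v₀ ∧ Literature.Analysis.FluidPDE.NSWave0.IsDivFree v₀ ∧ Literature.Analysis.FluidPDE.HasRapidSpatialDecay v₀ ∧ ¬ ∃ (u : ℝ → EuclideanSpace ℝ (Fin 3) → EuclideanSpace ℝ (Fin 3)) (p : ℝ → EuclideanSpace ℝ (Fin 3) → ℝ), Literature.Analysis.FluidPDE.IsSmoothOnHalfSpace u ∧ Literature.Analysis.FluidPDE.IsSmoothOnHalfSpace p ∧ Literature.Analysis.FluidPDE.IsNavierStokesSolution ν 0 v₀ u p ∧ Literature.Analysis.FluidPDE.HasBoundedEnergy u) → Literature.Analysis.FluidPDE.rusinSverakRhoMaxPure ν < ⊤) →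
    (∀ ν : ℝ, 0 < ν → Literature.Analysis.FluidPDE.rusinSverakRhoMaxPure ν < ⊤ → ∀ N : ℕ, ∃ p : ℕ, N ≤ p ∧ 2 ≤ p ∧ ∃ (u₀ : EuclideanSpace ℝ (Fin 3) → EuclideanSpace ℝ (Fin 3)) (g : Literature.Analysis.FunctionSpaces.HomSobolev (EuclideanSpace ℝ (Fin 3)) (EuclideanSpace ℂ (Fin 3)) (1 / 2 : ℝ)), Literature.Analysis.FluidPDE.IsMinimalBlowupDatum ν u₀ g ∧ ∃ (lam : ℝ) (x₀ : EuclideanSpace ℝ (Fin 3)), 0 < lam ∧ ∀ᵐ x ∂(MeasureTheory.volume : MeasureTheory.Measure (EuclideanSpace ℝ (Fin 3))), Literature.Analysis.FluidPDE.rescaleData lam (fun y => u₀ (y - x₀)) (WithLp.toLp 2 ![Real.cos (2 * Real.pi / p) * x 0 - Real.sin (2 * Real.pi / p) * x 1, Real.sin (2 * Real.pi / p) * x 0 + Real.cos (2 * Real.pi / p) * x 1, x 2]) = WithLp.toLp 2 ![Real.cos (2 * Real.pi / p) * u₀ x 0 - Real.sin (2 * Real.pi / p) * u₀ x 1, Real.sin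 (2 * Real.pi / p) * u₀ x 0 + Real.cos (2 * Real.pi / p) * u₀ x 1, u₀ x 2]) →
    (∀ (ν : ℝ) (u₀ : EuclideanSpace ℝ (Fin 3) → EuclideanSpace ℝ (Fin 3)) (g : Literature.Analysis.FunctionSpaces.HomSobolev (EuclideanSpace ℝ (Fin 3)) (EuclideanSpace ℂ (Fin 3)) (1 / 2 : ℝ)), Literature.Analysis.FluidPDE.IsMinimalBlowupDatum ν u₀ g → ¬ (u₀ =ᵐ[(MeasureTheory.volume : MeasureTheory.Measure (EuclideanSpace ℝ (Fin 3)))] (0 : EuclideanSpace ℝ (Fin 3) → EuclideanSpace ℝ (Fin 3)))) →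
    (∀ (p : ℕ) (u₀ : EuclideanSpace ℝ (Fin 3) → EuclideanSpace ℝ (Fin 3)), MeasureTheory.MemLp u₀ 3 (MeasureTheory.volume : MeasureTheory.Measure (EuclideanSpace ℝ (Fin 3))) → ¬ (u₀ =ᵐ[(MeasureTheory.volume : MeasureTheory.Measure (EuclideanSpace ℝ (Fin 3)))] (0 : EuclideanSpace ℝ (Fin 3) → EuclideanSpace ℝ (Fin 3))) → ∀ (lam : ℝ) (x₀ : EuclideanSpace ℝ (Fin 3)), 0 < lam → (∀ᵐ x ∂(MeasureTheory.volume : MeasureTheory.Measure (EuclideanSpace ℝ (Fin 3))), Literature.Analysis.FluidPDE.rescaleData lam (fun y => u₀ (y - x₀)) (WithLp.toLp 2 ![Real.cos (2 * Real.pi / p) * x 0 - Real.sin (2 * Real.pi / p) * x 1, Real.sin (2 * Real.pi / p) * x 0 + Real.cos (2 * Real.pi / p) * x 1, x 2]) = WithLp.toLp 2 ![Real.cos (2 * Real.pi / p) * u₀ x 0 - Real.sin (2 * Real.pi / p) * u₀ x 1, Real.sin (2 * Real.pi / p) * u₀ x 0 + Real.cos (2 * Real.pi / p) * u₀ x 1,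 u₀ x 2]) → lam = 1) →
    (∀ (p : ℕ) (u₀ : EuclideanSpace ℝ (Fin 3) → EuclideanSpace ℝ (Fin 3)), MeasureTheory.MemLp u₀ 3 (MeasureTheory.volume : MeasureTheory.Measure (EuclideanSpace ℝ (Fin 3))) → ¬ (u₀ =ᵐ[(MeasureTheory.volume : MeasureTheory.Measure (EuclideanSpace ℝ (Fin 3)))] (0 : EuclideanSpace ℝ (Fin 3) → EuclideanSpace ℝ (Fin 3))) → ∀ x₀ : EuclideanSpace ℝ (Fin 3), (∀ᵐ x ∂(MeasureTheory.volume : MeasureTheory.Measure (EuclideanSpace ℝ (Fin 3))), u₀ (WithLp.toLp 2 ![Real.cos (2 * Real.pi / p) * x 0 - Real.sin (2 * Real.pi / p) * x 1, Real.sin (2 * Real.pi / p) * x 0 + Real.cos (2 * Real.pi / p) * x 1, x 2] - x₀) = WithLp.toLp 2 ![Real.cos (2 * Real.pi / p) * u₀ x 0 - Real.sin (2 * Real.pi / p) * u₀ x 1, Real.sin (2 * Real.pi / p) * u₀ x 0 + Real.cos (2 * Real.pi / p) * u₀ x 1, u₀ x 2]) → x₀ 2 = 0) →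
    (∀ (ν : ℝ) (p : ℕ), 2 ≤ p → ∀ (u₀ : EuclideanSpace ℝ (Fin 3) → EuclideanSpace ℝ (Fin 3)) (g : Literature.Analysis.FunctionSpaces.HomSobolev (EuclideanSpace ℝ (Fin 3)) (EuclideanSpace ℂ (Fin 3)) (1 / 2 : ℝ)), Literature.Analysis.FluidPDE.IsMinimalBlowupDatum ν u₀ g → ∀ x₀ : EuclideanSpace ℝ (Fin 3), x₀ 2 = 0 → (∀ᵐ x ∂(MeasureTheory.volume : MeasureTheory.Measure (EuclideanSpace ℝ (Fin 3))), u₀ (WithLp.toLp 2 ![Real.cos (2 * Real.pi / p) * x 0 - Real.sin (2 * Real.pi / p) * x 1, Real.sin (2 * Real.pi / p) * x 0 + Real.cos (2 * Real.pi / p) * x 1, x 2] - x₀) = WithLp.toLp 2 ![Real.cos (2 * Real.pi / p) * u₀ x 0 - Real.sin (2 * Real.pi / p) * u₀ x 1, Real.sin (2 * Real.pi / p) * u₀ x 0 + Real.cos (2 * Real.pi / p) * u₀ x 1, u₀ x 2]) → ∃ (u₁ : EuclideanSpace ℝ (Fin 3) → EuclideanSpace ℝ (Fin 3)) (g₁ :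 Literature.Analysis.FunctionSpaces.HomSobolev (EuclideanSpace ℝ (Fin 3)) (EuclideanSpace ℂ (Fin 3)) (1 / 2 : ℝ)), Literature.Analysis.FluidPDE.IsMinimalBlowupDatum ν u₁ g₁ ∧ ∀ᵐ x ∂(MeasureTheory.volume : MeasureTheory.Measure (EuclideanSpace ℝ (Fin 3))), u₁ (WithLp.toLp 2 ![Real.cos (2 * Real.pi / p) * x 0 - Real.sin (2 * Real.pi / p) * x 1, Real.sin (2 * Real.pi / p) * x 0 + Real.cos (2 * Real.pi / p) * x 1, x 2]) = WithLp.toLp 2 ![Real.cos (2 * Real.pi / p) * u₁ x 0 - Real.sin (2 * Real.pi / p) * u₁ x 1, Real.sin (2 * Real.pi / p) * u₁ x 0 + Real.cos (2 * Real.pi / p) * u₁ x 1, u₁ x 2]) →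
    (∀ (ν : ℝ) (p : ℕ), 2 ≤ p → ∀ (u₁ : EuclideanSpace ℝ (Fin 3) → EuclideanSpace ℝ (Fin 3)) (g₁ : Literature.Analysis.FunctionSpaces.HomSobolev (EuclideanSpace ℝ (Fin 3)) (EuclideanSpace ℂ (Fin 3)) (1 / 2 : ℝ)), Literature.Analysis.FluidPDE.IsMinimalBlowupDatum ν u₁ g₁ → (∀ᵐ x ∂(MeasureTheory.volume : MeasureTheory.Measure (EuclideanSpace ℝ (Fin 3))), u₁ (WithLp.toLp 2 ![Real.cos (2 * Real.pi / p) * x 0 - Real.sin (2 * Real.pi / p) * x 1, Real.sin (2 * Real.pi / p) * x 0 + Real.cos (2 * Real.pi / p) * x 1, x 2]) = WithLp.toLp 2 ![Real.cos (2 * Real.pi / p) * u₁ x 0 - Real.sin (2 * Real.pi / p) * u₁ x 1, Real.sin (2 * Real.pi / p) * u₁ x 0 + Real.cos (2 * Real.pi / p) * u₁ x 1, u₁ x 2]) → ∃ (u₂ : EuclideanSpace ℝ (Fin 3) → EuclideanSpace ℝ (Fin 3)) (g₂ : Literature.Analysis.FunctionSpaces.HomSobolev (EuclideanSpace ℝ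 (Fin 3)) (EuclideanSpace ℂ (Fin 3)) (1 / 2 : ℝ)), Literature.Analysis.FluidPDE.IsMinimalBlowupDatum ν u₂ g₂ ∧ ∀ x : EuclideanSpace ℝ (Fin 3), u₂ (WithLp.toLp 2 ![Real.cos (2 * Real.pi / p) * x 0 - Real.sin (2 * Real.pi / p) * x 1, Real.sin (2 * Real.pi / p) * x 0 + Real.cos (2 * Real.pi / p) * x 1, x 2]) = WithLp.toLp 2 ![Real.cos (2 * Real.pi / p) * u₂ x 0 - Real.sin (2 * Real.pi / p) * u₂ x 1, Real.sin (2 * Real.pi / p) * u₂ x 0 + Real.cos (2 * Real.pi / p) * u₂ x 1, u₂ x 2]) →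
      ∀ ν : ℝ, 0 < ν → (∃ v₀ : EuclideanSpace ℝ (Fin 3) → EuclideanSpace ℝ (Fin 3), ContDiff ℝ (⊤ : ℕ∞) v₀ ∧ Literature.Analysis.FluidPDE.NSWave0.IsDivFree v₀ ∧ Literature.Analysis.FluidPDE.HasRapidSpatialDecay v₀ ∧ ¬ ∃ (u : ℝ → EuclideanSpace ℝ (Fin 3) → EuclideanSpace ℝ (Fin 3)) (p : ℝ → EuclideanSpace ℝ (Fin 3) → ℝ), Literature.Analysis.FluidPDE.IsSmoothOnHalfSpace u ∧ Literature.Analysis.FluidPDE.IsSmoothOnHalfSpace p ∧ Literature.Analysis.FluidPDE.IsNavierStokesSolution ν 0 v₀ u p ∧ Literature.Analysis.FluidPDE.HasBoundedEnergy u) → ∀ N : ℕ, ∃ p : ℕ, N ≤ p ∧ 2 ≤ p ∧ ∃ (u₀ : EuclideanSpace ℝ (Fin 3) → EuclideanSpace ℝ (Fin 3)) (g : Literature.Analysis.FunctionSpaces.HomSobolev (EuclideanSpace ℝ (Fin 3)) (EuclideanSpace ℂ (Fin 3)) (1 / 2 : ℝ)), Literature.Analysis.FluidPDE.IsMinimalBlowupDatum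 ν u₀ g ∧ ∀ x : EuclideanSpace ℝ (Fin 3), u₀ (WithLp.toLp 2 ![Real.cos (2 * Real.pi / p) * x 0 - Real.sin (2 * Real.pi / p) * x 1, Real.sin (2 * Real.pi / p) * x 0 + Real.cos (2 * Real.pi / p) * x 1, x 2]) = WithLp.toLp 2 ![Real.cos (2 * Real.pi / p) * u₀ x 0 - Real.sin (2 * Real.pi / p) * u₀ x 1, Real.sin (2 * Real.pi / p) * u₀ x 0 + Real.cos (2 * Real.pi / p) * u₀ x 1, u₀ x 2] := by
  intro h₁ h₂ h₃ h₄ h₅ h₆ h₇ ν hν hclay N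
  obtain ⟨p, hNp, h2p, u₀, g, hmin, lam, x₀, hlam, hfix⟩ := h₂ ν hν (h₁ ν hν hclay) N
  have hne : ¬ (u₀ =ᵐ[(MeasureTheory.volume : MeasureTheory.Measure (EuclideanSpace ℝ (Fin 3)))]
      (0 : EuclideanSpace ℝ (Fin 3) → EuclideanSpace ℝ (Fin 3))) := h₃ ν u₀ g hmin
  have hL3 : MeasureTheory.MemLp u₀ 3 (MeasureTheory.volume : MeasureTheory.Measure (EuclideanSpace ℝ (Fin 3))) := by
    obtain ⟨h3, -, -, -, -⟩ := hmin
    exact h3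
  obtain rfl : lam = 1 := h₄ p u₀ hL3 hne lam x₀ hlam hfix
  have hfix' : ∀ᵐ x ∂(MeasureTheory.volume : MeasureTheory.Measure (EuclideanSpace ℝ (Fin 3))),
      u₀ (WithLp.toLp 2 ![Real.cos (2 * Real.pi / p) * x 0 - Real.sin (2 * Real.pi / p) * x 1, Real.sin (2 * Real.pi / p) * x 0 + Real.cos (2 * Real.pi / p) * x 1, x 2] - x₀) =
        WithLp.toLp 2 ![Real.cos (2 * Real.pi / p) * u₀ x 0 - Real.sin (2 * Real.pi / p) * u₀ x 1, Real.sin (2 * Real.pi / p) * u₀ x 0 + Real.cos (2 * Real.pi / p) * u₀ x 1, u₀ x 2] := by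
    filter_upwards [hfix] with x hx
    simpa only [Literature.Analysis.FluidPDE.rescaleData, one_smul] using hx
  have hx₀ : x₀ 2 = 0 := h₅ p u₀ hL3 hne x₀ hfix'
  obtain ⟨u₁, g₁, hmin₁, hfix₁⟩ := h₆ ν p h2p u₀ g hmin x₀ hx₀ hfix'
  obtain ⟨u₂, g₂, hmin₂, hsym⟩ := h₇ ν p h2p u₁ g₁ hmin₁ hfix₁
  exact ⟨p, hNp, h2p, u₂, g₂, hmin₂, hsym⟩

/-- The written-out conclusion of `MinimalDatumPFold_of_sigs` IS the crux decl (definitional, `Iff.rfl`). -/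
theorem MinimalDatumPFold_iff_written :
    Summit.NavierStokesRegularity.NavierStokesRegularity.Theses.AxisymmetricExtremality.MinimalDatumPFold ↔
      (∀ ν : ℝ, 0 < ν → (∃ v₀ : EuclideanSpace ℝ (Fin 3) → EuclideanSpace ℝ (Fin 3), ContDiff ℝ (⊤ : ℕ∞) v₀ ∧ Literature.Analysis.FluidPDE.NSWave0.IsDivFree v₀ ∧ Literature.Analysis.FluidPDE.HasRapidSpatialDecay v₀ ∧ ¬ ∃ (u : ℝ → EuclideanSpace ℝ (Fin 3) → EuclideanSpace ℝ (Fin 3)) (p : ℝ → EuclideanSpace ℝ (Fin 3) → ℝ), Literature.Analysis.FluidPDE.IsSmoothOnHalfSpace u ∧ Literature.Analysis.FluidPDE.IsSmoothOnHalfSpace p ∧ Literature.Analysis.FluidPDE.IsNavierStokesSolution ν 0 v₀ u p ∧ Literature.Analysis.FluidPDE.HasBoundedEnergy u) → ∀ N : ℕ, ∃ p : ℕ, N ≤ p ∧ 2 ≤ p ∧ ∃ (u₀ : EuclideanSpace ℝ (Fin 3) → EuclideanSpace ℝ (Fin 3)) (g : Literature.Analysis.FunctionSpaces.HomSobolev (EuclideanSpace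 ℝ (Fin 3)) (EuclideanSpace ℂ (Fin 3)) (1 / 2 : ℝ)), Literature.Analysis.FluidPDE.IsMinimalBlowupDatum ν u₀ g ∧ ∀ x : EuclideanSpace ℝ (Fin 3), u₀ (WithLp.toLp 2 ![Real.cos (2 * Real.pi / p) * x 0 - Real.sin (2 * Real.pi / p) * x 1, Real.sin (2 * Real.pi / p) * x 0 + Real.cos (2 * Real.pi / p) * x 1, x 2]) = WithLp.toLp 2 ![Real.cos (2 * Real.pi / p) * u₀ x 0 - Real.sin (2 * Real.pi / p) * u₀ x 1, Real.sin (2 * Real.pi / p) * u₀ x 0 + Real.cos (2 * Real.pi / p) * u₀ x 1, u₀ x 2]) :=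
  Iff.rfl

/-- THE SKELETON THEOREM (registered target): the crux `AxisymmetricExtremality.MinimalDatumPFold` BY NAME,
with no hypotheses, from the seven DECLARED stubs through the sorry-free composition
`MinimalDatumPFold_of_sigs` — `sorryAx` is reached exactly through the stubs (the only sorries of the file). -/
theorem MinimalDatumPFold_of : Summit.NavierStokesRegularity.NavierStokesRegularity.Theses.AxisymmetricExtremality.MinimalDatumPFold :=
  MinimalDatumPFold_iff_written.mpr
    (MinimalDatumPFold_of_sigs stub_thresholdFinite_of_clayFailure stub_smithFixedModSim
      stub_minimalDatum_not_aeZero stub_liftScaleRigidity stub_liftShiftRigidity stub_liftRecentre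
      stub_liftAeToExact)

end Summit.NavierStokesRegularity.NavierStokesRegularity.Cruxes.MinimalDatumPFold.Birth
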